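import Literature.NumberTheory.EllipticCurves.FineSelmerPExtensionDescentProofs
import Literature.NumberTheory.IwasawaTheory.ClassicalMuVanishesUnramifiedClassesProofs
import HarnessLib

/-!
# Lim 2017, Thm. 3.5 («if» direction, `L`-form of Coates–Sujatha 2005 Thm. 3.4, for `E/ℚ`, odd `p`) is a TREE THEOREM:
# discharge of the named fact `Lim2017.thm35_fineSelmerDual_moduleFinite_of_classicalMuVanishes_of_le_divisionField`

`Proofs`-style file (theorems only: no definition, no named fact, no `sorry`) in topic `NumberTheory/EllipticCurves`, namespace
`Literature.NumberTheory.EllipticCurves.Lim2017` (that of the named fact, file `FineSelmerClassGroupCriterion.lean`), written by the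
prover seat `bsd-potss-rkm` g34 (cell `bsd-potss`, item stmt-BirchSwinnertonDyer-19196; closes nothing).

THE THEOREM (`thm35_fineSelmerDual_moduleFinite_of_classicalMuVanishes_of_le_divisionField_holds`): for `E/ℚ` elliptic, `p` odd,
`L ⊆ ℚ(E[p])` with `[ℚ(E[p]) : ℚ] = p^k [L : ℚ]`, if Iwasawa's classical `μ` vanishes (growth form, `ClassicalMuVanishes`) for the
cyclotomic `ℤ_p`-extension(s) of `L`, then the dual fine Selmer group of `E` over `ℚ_cyc` is finitely generated over `ℤ_p`
(Coates–Sujatha's statement (A)).  Proof: g33's reduction `FineSelmerPExtensionDescent.thm35_of_classicalMuVanishes_finite_unramifiedClasses`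
(p-group flag on `E[p]`, dévissage, restriction; NO Iwasawa 1973 `μ`-transfer) composed with the discharge
`IwasawaTheory.ClassicalMuVanishesUnramifiedClasses.classicalMuVanishes_finite_unramifiedClasses_holds` (g34: Iwasawa's `μ = 0` in
character form, proved at finite level without structure theory).  Net effect for the tree: the named fact's ≈ 20 consumers
(μ-road doors, unit-index records, `DivisionFieldUnipotentStabilizer`) hold with `hLim` DISCHARGED.

HONEST FRAMING: this proves the typed («if», weaker-than-print) statement, not Lim's «only if»; nothing about BSD.

References: [Lim2017FineSelmer] M. F. Lim, *Notes on the fine Selmer groups*, Asian J. Math. 21 (2017), §3 Thm. 3.5, Lemma 3.2;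
[CoatesSujatha2005] Thm. 3.4; [Lang1990] Ch. 5 §§1–4; [Washington1997] §13.3.
-/

set_option autoImplicit false

noncomputable section

namespace Literature.NumberTheory.EllipticCurves.Lim2017

open Literature.NumberTheory.IwasawaTheory Literature.NumberTheory.EllipticCurves

/-- **Lim 2017 Thm. 3.5 («if» direction, `E/ℚ`, odd `p`) — DISCHARGE of the named fact
`thm35_fineSelmerDual_moduleFinite_of_classicalMuVanishes_of_le_divisionField`**: `FineSelmerPExtensionDescent.thm35_of_…` applied to
`classicalMuVanishes_finite_unramifiedClasses_holds`. [cite: Lim2017FineSelmer, §3 Thm. 3.5 and Lemma 3.2 (arXiv:1306.2047 pp. 6–7)]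
[cite: CoatesSujatha2005, Thm. 3.4] [cite: Lang1990, Ch. 5 §1 Thm. 1.2 (iii), §4 pp. 137–143] -/
theorem thm35_fineSelmerDual_moduleFinite_of_classicalMuVanishes_of_le_divisionField_holds :
    thm35_fineSelmerDual_moduleFinite_of_classicalMuVanishes_of_le_divisionField :=
  FineSelmerPExtensionDescent.thm35_of_classicalMuVanishes_finite_unramifiedClasses
    ClassicalMuVanishesUnramifiedClasses.classicalMuVanishes_finite_unramifiedClasses_holds

end Literature.NumberTheory.EllipticCurves.Lim2017

end
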